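import Summits.ABC.StewartYu.GenThreeInductionOdd
import Mathlib.Analysis.SpecialFunctions.Log.Basic
import HarnessLib

/-!
# Cell abc-stewartyu, WP-L.P(odd) (RouteGA crux `PadicCoreOddRat`): MATVEEV'S INDUCTION SHELL WITHOUT THE KUMMER CONDITION —
# the Kummer-free rank-indexed internal statement, the per-rank dichotomy, and the Matveev step from exit C

`Summits/ABC/StewartYu/GenThreeInductionOddRat.lean` — cell `abc-stewartyu` (HOME `run/shared/lean/pub/abc-stewartyu/`, design memo
HOME/p2/memo-07-WPLP-odd-Nframe-design.md §2 row «shells»; seat p2-g5).  Theorems and three plain `Prop`-valued definitions; no named fact,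
place-light.  The Kummer-FREE twin of p4-g3's `GenThreeInductionOdd` + `GenThreeStepOdd`:

* `CoreOddRat C p r` — the text of `GenThreeInductionOdd.CoreOdd C p r` with the signed-2-Kummer binder DELETED (= the body of the draft
  crux `PadicCoreOddRat` of RouteGA at one `p`, one `r`, one constant function `C`); `StepOddRat`, `DichotomyOddRat` likewise;
* `coreRat_of_dichotomy` — strong induction on the rank, VERBATIM the landed `core_of_dichotomy` minus the Kummer binders; the point of the
  saturated design (memo §1 (L4)): the induction hypothesis is the Kummer-free statement at the lower rank, each rank instance saturates
  internally, so Matveev's step NO LONGER has to transport a Kummer condition;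
* `dichotomyOddRat_of_not_le`, `stepOddRat_of_pow_eq` — working forms;
* `CoreOddRatPos`, `StepOddRatPos`, `DichotomyOddRatPos`, `coreRatPos_of_dichotomy`, … — the same with POSITIVE generators (the form the
  saturated frame delivers: the saturation lives in `ℚ_{>0}`), and **`coreOddRat_of_pos`**: all signs from positive generators by SQUARING the
  generators (`θᵢ ↦ θᵢ²`, weights `2Aᵢ`; constant `c ↦ 4c`); the Matveev step from exit C is the sequel `GenThreeStepOddRat`;
* `coreOddRat_iff` — `(∃ c, ∀ p odd prime, ∀ r, CoreOddRat (c^·) p r)` is literally RouteGA's `PadicCoreOddRat` text (stated here against a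
  local copy `PadicCoreOddRatText`, since the route is a draft and has no Theses file yet).

WHAT THIS IS NOT: no analytic content; no frame; no crux moves (RouteGA is not open).

References: Yu. V. Nesterenko, LNM 1819 (2003), Thm 2.1 via Prop. 2.6, §5.2 (5.22); K. Yu, Forum Math. 19 (2007), Main Thm (`K = ℚ`).
-/

noncomputable section

open Finset
open Literature.NumberTheory.Transcendental

namespace Summit.ABC.StewartYu.GenThreeInductionOddRat

open Summit.ABC.StewartYu.GenThreeInductionOdd (div_log_nonneg unit_prod_zpow zpow_prod_zpow_ne_one padicValRat_le_of_pow_eq)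

/-! ### The Kummer-free rank-indexed internal statements -/

/-- **The Kummer-free internal induction statement of the odd-`p` engine at rank `r`**: for rational `p`-adic units `θᵢ`,
multiplicatively independent, weights `h(θᵢ) ≤ Aᵢ`, `1 ≤ Aᵢ ≤ Amax`, exponents `m ≠ 0` with `log max(3,|mᵢ|) ≤ W`, `1 ≤ W`:
`ord_p(∏ θᵢ^{mᵢ} − 1)·log p ≤ C(r)·(p/log p)·∏ Aᵢ·(W + log p + log 2Amax)` — `GenThreeInductionOdd.CoreOdd` WITHOUT its Kummer binder.
[cite: Yu2007, Main Thm (K = ℚ); shape only] -/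
def CoreOddRat (C : ℕ → ℝ) (p r : ℕ) : Prop :=
  ∀ (θ : Fin r → ℚ) (m : Fin r → ℤ) (A : Fin r → ℝ) (Amax W : ℝ),
    (∀ i, θ i ≠ 0 ∧ padicValRat p (θ i) = 0) →
    (∀ μ : Fin r → ℤ, ∏ i, θ i ^ μ i = 1 → μ = 0) →
    (∀ i, Height.logHeight₁ (θ i) ≤ A i) → (∀ i, 1 ≤ A i) → (∀ i, A i ≤ Amax) →
    m ≠ 0 → (∀ i, Real.log (max 3 (|m i| : ℝ)) ≤ W) → 1 ≤ W →
    (padicValRat p (∏ i, θ i ^ m i - 1) : ℝ) * Real.log p ≤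
      C r * ((p : ℝ) / Real.log p) * (∏ i, A i) * (W + Real.log p + Real.log (2 * Amax))

/-- **The data of one Kummer-free Matveev step at rank `n`, odd `p`**: a rank `r < n`, new generators/exponents/weights satisfying every
hypothesis of `CoreOddRat C p r`, the valuation comparison and the (5.22) cost inequality. [cite: Nesterenko2003, Prop 2.6 and (5.22)] -/
def StepOddRat (C : ℕ → ℝ) (p n : ℕ) (α : Fin n → ℚ) (b : Fin n → ℤ) (V : Fin n → ℝ) (Vmax W : ℝ) : Prop :=
  ∃ (r : ℕ) (θ : Fin r → ℚ) (m : Fin r → ℤ) (A : Fin r → ℝ) (Amax W' : ℝ), r < n ∧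
    (∀ i, θ i ≠ 0 ∧ padicValRat p (θ i) = 0) ∧
    (∀ μ : Fin r → ℤ, ∏ i, θ i ^ μ i = 1 → μ = 0) ∧
    (∀ i, Height.logHeight₁ (θ i) ≤ A i) ∧ (∀ i, 1 ≤ A i) ∧ (∀ i, A i ≤ Amax) ∧
    m ≠ 0 ∧ (∀ i, Real.log (max 3 (|m i| : ℝ)) ≤ W') ∧ 1 ≤ W' ∧
    padicValRat p (∏ j, α j ^ b j - 1) ≤ padicValRat p (∏ i, θ i ^ m i - 1) ∧
    C r * (∏ i, A i) * (W' + Real.log p + Real.log (2 * Amax)) ≤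
      C n * (∏ j, V j) * (W + Real.log p + Real.log (2 * Vmax))

/-- **The Kummer-free per-rank dichotomy at odd `p`**: for every rank-`n` datum of `CoreOddRat`, the bound holds or a Kummer-free Matveev
step exists. [cite: Nesterenko2003, Prop 2.6] -/
def DichotomyOddRat (C : ℕ → ℝ) (p n : ℕ) : Prop :=
  ∀ (α : Fin n → ℚ) (b : Fin n → ℤ) (V : Fin n → ℝ) (Vmax W : ℝ),
    (∀ j, α j ≠ 0 ∧ padicValRat p (α j) = 0) →
    (∀ μ : Fin n → ℤ, ∏ j, α j ^ μ j = 1 → μ = 0) →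
    (∀ j, Height.logHeight₁ (α j) ≤ V j) → (∀ j, 1 ≤ V j) → (∀ j, V j ≤ Vmax) →
    b ≠ 0 → (∀ j, Real.log (max 3 (|b j| : ℝ)) ≤ W) → 1 ≤ W →
    (padicValRat p (∏ j, α j ^ b j - 1) : ℝ) * Real.log p ≤
        C n * ((p : ℝ) / Real.log p) * (∏ j, V j) * (W + Real.log p + Real.log (2 * Vmax)) ∨
      StepOddRat C p n α b V Vmax W

/-- **The positive-generator form** of the Kummer-free internal statement (the form the induction runs on; `CoreOddRat` for all signs
follows by squaring the generators, `coreOddRat_of_pos`). [cite: Yu2007, Main Thm (K = ℚ); shape only] -/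
def CoreOddRatPos (C : ℕ → ℝ) (p r : ℕ) : Prop :=
  ∀ (θ : Fin r → ℚ) (m : Fin r → ℤ) (A : Fin r → ℝ) (Amax W : ℝ),
    (∀ i, 0 < θ i) → (∀ i, θ i ≠ 0 ∧ padicValRat p (θ i) = 0) →
    (∀ μ : Fin r → ℤ, ∏ i, θ i ^ μ i = 1 → μ = 0) →
    (∀ i, Height.logHeight₁ (θ i) ≤ A i) → (∀ i, 1 ≤ A i) → (∀ i, A i ≤ Amax) →
    m ≠ 0 → (∀ i, Real.log (max 3 (|m i| : ℝ)) ≤ W) → 1 ≤ W →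
    (padicValRat p (∏ i, θ i ^ m i - 1) : ℝ) * Real.log p ≤
      C r * ((p : ℝ) / Real.log p) * (∏ i, A i) * (W + Real.log p + Real.log (2 * Amax))

/-- **One Kummer-free Matveev step with positive new generators.** [cite: Nesterenko2003, Prop 2.6 and (5.22)] -/
def StepOddRatPos (C : ℕ → ℝ) (p n : ℕ) (α : Fin n → ℚ) (b : Fin n → ℤ) (V : Fin n → ℝ) (Vmax W : ℝ) : Prop :=
  ∃ (r : ℕ) (θ : Fin r → ℚ) (m : Fin r → ℤ) (A : Fin r → ℝ) (Amax W' : ℝ), r < n ∧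
    (∀ i, 0 < θ i) ∧ (∀ i, θ i ≠ 0 ∧ padicValRat p (θ i) = 0) ∧
    (∀ μ : Fin r → ℤ, ∏ i, θ i ^ μ i = 1 → μ = 0) ∧
    (∀ i, Height.logHeight₁ (θ i) ≤ A i) ∧ (∀ i, 1 ≤ A i) ∧ (∀ i, A i ≤ Amax) ∧
    m ≠ 0 ∧ (∀ i, Real.log (max 3 (|m i| : ℝ)) ≤ W') ∧ 1 ≤ W' ∧
    padicValRat p (∏ j, α j ^ b j - 1) ≤ padicValRat p (∏ i, θ i ^ m i - 1) ∧
    C r * (∏ i, A i) * (W' + Real.log p + Real.log (2 * Amax)) ≤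
      C n * (∏ j, V j) * (W + Real.log p + Real.log (2 * Vmax))

/-- **The Kummer-free per-rank dichotomy for positive generators.** [cite: Nesterenko2003, Prop 2.6] -/
def DichotomyOddRatPos (C : ℕ → ℝ) (p n : ℕ) : Prop :=
  ∀ (α : Fin n → ℚ) (b : Fin n → ℤ) (V : Fin n → ℝ) (Vmax W : ℝ),
    (∀ j, 0 < α j) → (∀ j, α j ≠ 0 ∧ padicValRat p (α j) = 0) →
    (∀ μ : Fin n → ℤ, ∏ j, α j ^ μ j = 1 → μ = 0) →
    (∀ j, Height.logHeight₁ (α j) ≤ V j) → (∀ j, 1 ≤ V j) → (∀ j, V j ≤ Vmax) →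
    b ≠ 0 → (∀ j, Real.log (max 3 (|b j| : ℝ)) ≤ W) → 1 ≤ W →
    (padicValRat p (∏ j, α j ^ b j - 1) : ℝ) * Real.log p ≤
        C n * ((p : ℝ) / Real.log p) * (∏ j, V j) * (W + Real.log p + Real.log (2 * Vmax)) ∨
      StepOddRatPos C p n α b V Vmax W

/-! ### The inductions -/

/-- **Matveev's induction on the number of logarithms, odd `p`, Kummer-free**: the per-rank dichotomy for every rank gives the internal
statement for every rank. [cite: Nesterenko2003, Thm 2.1 from Prop 2.6] -/
theorem coreRat_of_dichotomy {C : ℕ → ℝ} {p : ℕ} (hD : ∀ n, DichotomyOddRat C p n) : ∀ r, CoreOddRat C p r := by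
  intro r
  induction r using Nat.strong_induction_on with
  | _ n ih =>
    intro α b V Vmax W hα hind hV hV1 hVmax hb hW hW1
    rcases hD n α b V Vmax W hα hind hV hV1 hVmax hb hW hW1 with hle | hstep
    · exact hle
    · obtain ⟨r, θ, m, A, Amax, W', hr, hθ, hindθ, hA, hA1, hAmax, hm, hW', hW1', hval, hcost⟩ := hstep
      have hIH := ih r hr θ m A Amax W' hθ hindθ hA hA1 hAmax hm hW' hW1'
      have hlogp : 0 ≤ Real.log p := Real.log_natCast_nonneg p
      have hval' : (padicValRat p (∏ j, α j ^ b j - 1) : ℝ) * Real.log p ≤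
          (padicValRat p (∏ i, θ i ^ m i - 1) : ℝ) * Real.log p :=
        mul_le_mul_of_nonneg_right (by exact_mod_cast hval) hlogp
      have hcost' : C r * ((p : ℝ) / Real.log p) * (∏ i, A i) * (W' + Real.log p + Real.log (2 * Amax)) ≤
          C n * ((p : ℝ) / Real.log p) * (∏ j, V j) * (W + Real.log p + Real.log (2 * Vmax)) := by
        have h := mul_le_mul_of_nonneg_left hcost (div_log_nonneg p)
        calc C r * ((p : ℝ) / Real.log p) * (∏ i, A i) * (W' + Real.log p + Real.log (2 * Amax))
            = (p : ℝ) / Real.log p * (C r * (∏ i, A i) * (W' + Real.log p + Real.log (2 * Amax))) := by ring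
          _ ≤ (p : ℝ) / Real.log p * (C n * (∏ j, V j) * (W + Real.log p + Real.log (2 * Vmax))) := h
          _ = C n * ((p : ℝ) / Real.log p) * (∏ j, V j) * (W + Real.log p + Real.log (2 * Vmax)) := by ring
      exact hval'.trans (hIH.trans hcost')

/-- The frame's working form of the Kummer-free dichotomy: ASSUME the negated bound and produce the step. [cite: Nesterenko2003, §5.2] -/
theorem dichotomyOddRat_of_not_le {C : ℕ → ℝ} {p n : ℕ}
    (h : ∀ (α : Fin n → ℚ) (b : Fin n → ℤ) (V : Fin n → ℝ) (Vmax W : ℝ),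
      (∀ j, α j ≠ 0 ∧ padicValRat p (α j) = 0) →
      (∀ μ : Fin n → ℤ, ∏ j, α j ^ μ j = 1 → μ = 0) →
      (∀ j, Height.logHeight₁ (α j) ≤ V j) → (∀ j, 1 ≤ V j) → (∀ j, V j ≤ Vmax) →
      b ≠ 0 → (∀ j, Real.log (max 3 (|b j| : ℝ)) ≤ W) → 1 ≤ W →
      ¬ (padicValRat p (∏ j, α j ^ b j - 1) : ℝ) * Real.log p ≤
          C n * ((p : ℝ) / Real.log p) * (∏ j, V j) * (W + Real.log p + Real.log (2 * Vmax)) →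
      StepOddRat C p n α b V Vmax W) :
    DichotomyOddRat C p n := by
  intro α b V Vmax W hα hind hV hV1 hVmax hb hW hW1
  by_cases hle : (padicValRat p (∏ j, α j ^ b j - 1) : ℝ) * Real.log p ≤
      C n * ((p : ℝ) / Real.log p) * (∏ j, V j) * (W + Real.log p + Real.log (2 * Vmax))
  · exact Or.inl hle
  · exact Or.inr (h α b V Vmax W hα hind hV hV1 hVmax hb hW hW1 hle)

/-- **The Kummer-free step from the algebraic relation**: rank-`r` data (`r < n`) satisfying the hypotheses of `CoreOddRat C p r`, the
relation `∏ θᵐ = (∏ αᵇ)^{m₀}` (`m₀ ≠ 0`) and the cost inequality give `StepOddRat`. [cite: Nesterenko2003, Prop 2.6 (2.9)–(2.13)] -/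
theorem stepOddRat_of_pow_eq {C : ℕ → ℝ} {p : ℕ} [Fact p.Prime] {n : ℕ} {α : Fin n → ℚ} {b : Fin n → ℤ}
    {V : Fin n → ℝ} {Vmax W : ℝ} (hα : ∀ j, α j ≠ 0 ∧ padicValRat p (α j) = 0)
    (hind : ∀ μ : Fin n → ℤ, ∏ j, α j ^ μ j = 1 → μ = 0) (hb : b ≠ 0)
    {r : ℕ} (hr : r < n) (θ : Fin r → ℚ) (m : Fin r → ℤ) (A : Fin r → ℝ) (Amax W' : ℝ)
    (hθ : ∀ i, θ i ≠ 0 ∧ padicValRat p (θ i) = 0)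
    (hindθ : ∀ μ : Fin r → ℤ, ∏ i, θ i ^ μ i = 1 → μ = 0)
    (hA : ∀ i, Height.logHeight₁ (θ i) ≤ A i) (hA1 : ∀ i, 1 ≤ A i) (hAmax : ∀ i, A i ≤ Amax)
    (hW' : ∀ i, Real.log (max 3 (|m i| : ℝ)) ≤ W') (hW1' : 1 ≤ W')
    (m₀ : ℤ) (hm₀ : m₀ ≠ 0) (hrel : ∏ i, θ i ^ m i = (∏ j, α j ^ b j) ^ m₀)
    (hcost : C r * (∏ i, A i) * (W' + Real.log p + Real.log (2 * Amax)) ≤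
      C n * (∏ j, V j) * (W + Real.log p + Real.log (2 * Vmax))) :
    StepOddRat C p n α b V Vmax W := by
  have hm : m ≠ 0 := by
    intro hm0
    apply zpow_prod_zpow_ne_one α hind b hb m₀ hm₀
    rw [← hrel, hm0]
    simp
  exact ⟨r, θ, m, A, Amax, W', hr, hθ, hindθ, hA, hA1, hAmax, hm, hW', hW1',
    padicValRat_le_of_pow_eq α hα hind b hb θ m m₀ hm₀ hrel, hcost⟩

/-- **Matveev's induction for positive generators** (the same strong induction). [cite: Nesterenko2003, Thm 2.1 from Prop 2.6] -/
theorem coreRatPos_of_dichotomy {C : ℕ → ℝ} {p : ℕ} (hD : ∀ n, DichotomyOddRatPos C p n) : ∀ r, CoreOddRatPos C p r := by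
  intro r
  induction r using Nat.strong_induction_on with
  | _ n ih =>
    intro α b V Vmax W hpos hα hind hV hV1 hVmax hb hW hW1
    rcases hD n α b V Vmax W hpos hα hind hV hV1 hVmax hb hW hW1 with hle | hstep
    · exact hle
    · obtain ⟨r, θ, m, A, Amax, W', hr, hθpos, hθ, hindθ, hA, hA1, hAmax, hm, hW', hW1', hval, hcost⟩ := hstep
      have hIH := ih r hr θ m A Amax W' hθpos hθ hindθ hA hA1 hAmax hm hW' hW1'
      have hlogp : 0 ≤ Real.log p := Real.log_natCast_nonneg p
      have hval' : (padicValRat p (∏ j, α j ^ b j - 1) : ℝ) * Real.log p ≤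
          (padicValRat p (∏ i, θ i ^ m i - 1) : ℝ) * Real.log p :=
        mul_le_mul_of_nonneg_right (by exact_mod_cast hval) hlogp
      have hcost' : C r * ((p : ℝ) / Real.log p) * (∏ i, A i) * (W' + Real.log p + Real.log (2 * Amax)) ≤
          C n * ((p : ℝ) / Real.log p) * (∏ j, V j) * (W + Real.log p + Real.log (2 * Vmax)) := by
        have h := mul_le_mul_of_nonneg_left hcost (div_log_nonneg p)
        calc C r * ((p : ℝ) / Real.log p) * (∏ i, A i) * (W' + Real.log p + Real.log (2 * Amax))
            = (p : ℝ) / Real.log p * (C r * (∏ i, A i) * (W' + Real.log p + Real.log (2 * Amax))) := by ring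
          _ ≤ (p : ℝ) / Real.log p * (C n * (∏ j, V j) * (W + Real.log p + Real.log (2 * Vmax))) := h
          _ = C n * ((p : ℝ) / Real.log p) * (∏ j, V j) * (W + Real.log p + Real.log (2 * Vmax)) := by ring
      exact hval'.trans (hIH.trans hcost')

/-- Working form of the positive dichotomy: ASSUME the negated bound and produce the step. [cite: Nesterenko2003, §5.2] -/
theorem dichotomyOddRatPos_of_not_le {C : ℕ → ℝ} {p n : ℕ}
    (h : ∀ (α : Fin n → ℚ) (b : Fin n → ℤ) (V : Fin n → ℝ) (Vmax W : ℝ),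
      (∀ j, 0 < α j) → (∀ j, α j ≠ 0 ∧ padicValRat p (α j) = 0) →
      (∀ μ : Fin n → ℤ, ∏ j, α j ^ μ j = 1 → μ = 0) →
      (∀ j, Height.logHeight₁ (α j) ≤ V j) → (∀ j, 1 ≤ V j) → (∀ j, V j ≤ Vmax) →
      b ≠ 0 → (∀ j, Real.log (max 3 (|b j| : ℝ)) ≤ W) → 1 ≤ W →
      ¬ (padicValRat p (∏ j, α j ^ b j - 1) : ℝ) * Real.log p ≤
          C n * ((p : ℝ) / Real.log p) * (∏ j, V j) * (W + Real.log p + Real.log (2 * Vmax)) →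
      StepOddRatPos C p n α b V Vmax W) :
    DichotomyOddRatPos C p n := by
  intro α b V Vmax W hpos hα hind hV hV1 hVmax hb hW hW1
  by_cases hle : (padicValRat p (∏ j, α j ^ b j - 1) : ℝ) * Real.log p ≤
      C n * ((p : ℝ) / Real.log p) * (∏ j, V j) * (W + Real.log p + Real.log (2 * Vmax))
  · exact Or.inl hle
  · exact Or.inr (h α b V Vmax W hpos hα hind hV hV1 hVmax hb hW hW1 hle)

/-- **Positive step from the algebraic relation**: as `stepOddRat_of_pow_eq`, for positive `α` and new generators of the form
`θᵢ = ∏ αⱼ^{Zᵢⱼ}` (hence positive). [cite: Nesterenko2003, Prop 2.6 (2.9)–(2.13)] -/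
theorem stepOddRatPos_of_pow_eq {C : ℕ → ℝ} {p : ℕ} [Fact p.Prime] {n : ℕ} {α : Fin n → ℚ} {b : Fin n → ℤ}
    {V : Fin n → ℝ} {Vmax W : ℝ} (hpos : ∀ j, 0 < α j) (hα : ∀ j, α j ≠ 0 ∧ padicValRat p (α j) = 0)
    (hind : ∀ μ : Fin n → ℤ, ∏ j, α j ^ μ j = 1 → μ = 0) (hb : b ≠ 0)
    {r : ℕ} (hr : r < n) (θ : Fin r → ℚ) (Z : Fin r → Fin n → ℤ) (hθZ : ∀ i, θ i = ∏ j, α j ^ Z i j)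
    (m : Fin r → ℤ) (A : Fin r → ℝ) (Amax W' : ℝ)
    (hθ : ∀ i, θ i ≠ 0 ∧ padicValRat p (θ i) = 0)
    (hindθ : ∀ μ : Fin r → ℤ, ∏ i, θ i ^ μ i = 1 → μ = 0)
    (hA : ∀ i, Height.logHeight₁ (θ i) ≤ A i) (hA1 : ∀ i, 1 ≤ A i) (hAmax : ∀ i, A i ≤ Amax)
    (hW' : ∀ i, Real.log (max 3 (|m i| : ℝ)) ≤ W') (hW1' : 1 ≤ W')
    (m₀ : ℤ) (hm₀ : m₀ ≠ 0) (hrel : ∏ i, θ i ^ m i = (∏ j, α j ^ b j) ^ m₀)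
    (hcost : C r * (∏ i, A i) * (W' + Real.log p + Real.log (2 * Amax)) ≤
      C n * (∏ j, V j) * (W + Real.log p + Real.log (2 * Vmax))) :
    StepOddRatPos C p n α b V Vmax W := by
  have hm : m ≠ 0 := by
    intro hm0
    apply zpow_prod_zpow_ne_one α hind b hb m₀ hm₀
    rw [← hrel, hm0]
    simp
  have hθpos : ∀ i, 0 < θ i := fun i => by
    rw [hθZ i]; exact Finset.prod_pos fun j _ => zpow_pos (hpos j) _
  exact ⟨r, θ, m, A, Amax, W', hr, hθpos, hθ, hindθ, hA, hA1, hAmax, hm, hW', hW1',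
    padicValRat_le_of_pow_eq α hα hind b hb θ m m₀ hm₀ hrel, hcost⟩

/-! ### From positive generators to all signs: square the generators -/

/-- Independence of the squares: `∏ (θᵢ²)^{μᵢ} = 1 ⇒ μ = 0` when `∏ θᵢ^{μᵢ} = 1 ⇒ μ = 0` (apply to `2μ`). [folklore] -/
theorem mulIndep_sq {r : ℕ} (θ : Fin r → ℚ) (hind : ∀ μ : Fin r → ℤ, ∏ i, θ i ^ μ i = 1 → μ = 0) :
    ∀ μ : Fin r → ℤ, ∏ i, (θ i ^ 2) ^ μ i = 1 → μ = 0 := by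
  intro μ h
  have h2 : ∏ i, θ i ^ (2 * μ i) = 1 := by
    rw [← h]
    refine Finset.prod_congr rfl fun i _ => ?_
    rw [zpow_mul]; norm_cast
  have h3 := hind _ h2
  funext i
  have := congrFun h3 i
  simp only [Pi.zero_apply, mul_eq_zero, OfNat.ofNat_ne_zero, false_or] at this
  exact this

/-- `∏ (θᵢ²)^{mᵢ} = (∏ θᵢ^{mᵢ})²`. [folklore] -/
theorem prod_sq_zpow {r : ℕ} (θ : Fin r → ℚ) (m : Fin r → ℤ) : ∏ i, (θ i ^ 2) ^ m i = (∏ i, θ i ^ m i) ^ 2 := by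
  rw [← Finset.prod_pow]
  refine Finset.prod_congr rfl fun i _ => ?_
  rw [← zpow_natCast, ← zpow_natCast, ← zpow_mul, ← zpow_mul, mul_comm]

/-- **All signs from positive generators, by squaring** (odd `p`): if `CoreOddRatPos (c^·) p r` for every `r` and `0 ≤ c`, then
`CoreOddRat ((4c)^·) p r` for every `r`.  (Apply the positive statement to `θᵢ²`, weights `2Aᵢ`, `2Amax`, same `m`, `W`:
`ord_p(θ^m − 1) ≤ ord_p((θ^m)² − 1)` for `(θ^m)² ≠ 1` — and `θ^m = −1` gives `ord_p(−2) = 0` at odd `p` —, `∏ 2Aᵢ = 2ʳ∏Aᵢ`,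
`log 4Amax ≤ log 2 + log 2Amax ≤ W + log 2Amax`.) [cite: Yu2007, Main Thm (K = ℚ); shape only] -/
theorem coreOddRat_of_pos {c : ℝ} (hc : 0 ≤ c) {p : ℕ} [Fact p.Prime] (hp2 : p ≠ 2)
    (h : ∀ r, CoreOddRatPos (fun k => c ^ k) p r) : ∀ r, CoreOddRat (fun k => (4 * c) ^ k) p r := by
  intro r θ m A Amax W hθ hind hA hA1 hAmax hm hW hW1
  obtain ⟨hx0, hxv⟩ := unit_prod_zpow (p := p) θ hθ m
  have hr : 0 < r := by
    rcases Nat.eq_zero_or_pos r with h0 | h0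
    · subst h0; exact absurd (funext fun i => Fin.elim0 i) hm
    · exact h0
  have hΩ1 : 1 ≤ ∏ i, A i := Finset.one_le_prod fun i _ => hA1 i
  have hAmax1 : 1 ≤ Amax := (hA1 ⟨0, hr⟩).trans (hAmax ⟨0, hr⟩)
  have hlogp : 0 ≤ Real.log p := Real.log_natCast_nonneg p
  have hdiv : 0 ≤ (p : ℝ) / Real.log p := div_log_nonneg p
  have hlog2A : 0 ≤ Real.log (2 * Amax) := Real.log_nonneg (by linarith)
  have h4c : 0 ≤ (4 * c) ^ r := pow_nonneg (by linarith) r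
  have hRHS0 : 0 ≤ (4 * c) ^ r * ((p : ℝ) / Real.log p) * (∏ i, A i) * (W + Real.log p + Real.log (2 * Amax)) := by
    have : 0 ≤ W + Real.log p + Real.log (2 * Amax) := by linarith
    have h1 : 0 ≤ ∏ i, A i := by linarith
    positivity
  -- the degenerate case `θ^m = −1` (then `(θ^m)² = 1`): `ord_p(−2) = 0` at odd `p`
  by_cases hneg : ∏ i, θ i ^ m i = -1
  · have hval : padicValRat p (∏ i, θ i ^ m i - 1) = 0 := by
      rw [hneg, show (-1 : ℚ) - 1 = ((-2 : ℤ) : ℚ) by norm_num, padicValRat.of_int]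
      have hp : p.Prime := Fact.out
      have h2 : ¬ (p : ℤ) ∣ (-2 : ℤ) := by
        rw [Int.dvd_neg]
        intro hd
        have hd' : p ∣ 2 := by exact_mod_cast hd
        have := (Nat.le_of_dvd two_pos hd')
        have := hp.two_le
        omega
      simp [padicValInt.eq_zero_of_not_dvd h2]
    rw [hval]; simpa using hRHS0
  -- the main case: `(θ^m)² ≠ 1`
  have hx1 : ∏ i, θ i ^ m i ≠ 1 := fun h1 => hm (hind m h1)
  have hsq : (∏ i, θ i ^ m i) ^ (2 : ℤ) ≠ 1 := by
    rw [show ((2 : ℤ)) = ((2 : ℕ) : ℤ) by rfl, zpow_natCast]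
    exact sq_ne_one_iff.mpr ⟨hx1, hneg⟩
  have hle := Literature.Barriers.ABC.padicValRat_sub_one_le_zpow_sub_one hx0 hxv (n := 2) two_ne_zero hsq
  -- the positive statement for `θ²`
  have hθ2pos : ∀ i, 0 < θ i ^ 2 := fun i => by
    have := (hθ i).1; positivity
  have hθ2 : ∀ i, θ i ^ 2 ≠ 0 ∧ padicValRat p (θ i ^ 2) = 0 := fun i =>
    ⟨pow_ne_zero _ (hθ i).1, by rw [padicValRat.pow (θ i), (hθ i).2, mul_zero]⟩
  have hA2 : ∀ i, Height.logHeight₁ (θ i ^ 2) ≤ 2 * A i := fun i => by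
    rw [Height.logHeight₁_pow]; push_cast; linarith [hA i]
  have hA21 : ∀ i, 1 ≤ 2 * A i := fun i => by linarith [hA1 i]
  have hA2max : ∀ i, 2 * A i ≤ 2 * Amax := fun i => by linarith [hAmax i]
  have hpos := h r (fun i => θ i ^ 2) m (fun i => 2 * A i) (2 * Amax) W hθ2pos hθ2 (mulIndep_sq θ hind) hA2 hA21 hA2max hm hW hW1
  rw [prod_sq_zpow] at hpos
  -- compare the two right-hand sides
  have hprod2 : ∏ i, (2 * A i) = (2 : ℝ) ^ r * ∏ i, A i := by
    rw [Finset.prod_mul_distrib, Finset.prod_const, Finset.card_univ, Fintype.card_fin]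
  have hlog4 : Real.log (2 * (2 * Amax)) ≤ W + Real.log (2 * Amax) := by
    rw [show 2 * (2 * Amax) = 2 * (2 * Amax) by rfl, Real.log_mul (by norm_num) (by linarith)]
    have : Real.log 2 ≤ 1 := by
      have := Real.log_two_lt_d9; linarith
    linarith
  have hbr : W + Real.log p + Real.log (2 * (2 * Amax)) ≤ 2 * (W + Real.log p + Real.log (2 * Amax)) := by
    linarith
  have hzpow2 : (∏ i, θ i ^ m i) ^ (2 : ℤ) = (∏ i, θ i ^ m i) ^ 2 := by
    rw [show ((2 : ℤ)) = ((2 : ℕ) : ℤ) by rfl, zpow_natCast]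
  rw [hzpow2] at hle
  have hle' : (padicValRat p (∏ i, θ i ^ m i - 1) : ℝ) * Real.log p ≤
      (padicValRat p ((∏ i, θ i ^ m i) ^ 2 - 1) : ℝ) * Real.log p :=
    mul_le_mul_of_nonneg_right (by exact_mod_cast hle) hlogp
  refine hle'.trans (hpos.trans ?_)
  rw [hprod2]
  have hcr : 0 ≤ c ^ r := pow_nonneg hc r
  calc c ^ r * ((p : ℝ) / Real.log p) * ((2 : ℝ) ^ r * ∏ i, A i) * (W + Real.log p + Real.log (2 * (2 * Amax)))
      ≤ c ^ r * ((p : ℝ) / Real.log p) * ((2 : ℝ) ^ r * ∏ i, A i) * (2 * (W + Real.log p + Real.log (2 * Amax))) := by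
        refine mul_le_mul_of_nonneg_left hbr ?_
        have : 0 ≤ (2 : ℝ) ^ r * ∏ i, A i := by positivity
        positivity
    _ = (2 * (2 : ℝ) ^ r * c ^ r) * ((p : ℝ) / Real.log p) * (∏ i, A i) * (W + Real.log p + Real.log (2 * Amax)) := by ring
    _ ≤ (4 * c) ^ r * ((p : ℝ) / Real.log p) * (∏ i, A i) * (W + Real.log p + Real.log (2 * Amax)) := by
        have hWs : 0 ≤ W + Real.log p + Real.log (2 * Amax) := by linarith
        have hΩ0 : 0 ≤ ∏ i, A i := by linarith
        refine mul_le_mul_of_nonneg_right (mul_le_mul_of_nonneg_right (mul_le_mul_of_nonneg_right ?_ hdiv) hΩ0) hWs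
        -- `2·2ʳ·cʳ ≤ 4ʳ·cʳ` for `r ≥ 1`
        rw [mul_pow]
        have h22 : 2 * (2 : ℝ) ^ r ≤ (4 : ℝ) ^ r := by
          have : (4 : ℝ) ^ r = (2 : ℝ) ^ r * (2 : ℝ) ^ r := by
            rw [← mul_pow]; norm_num
          rw [this]
          have h2r : (2 : ℝ) ≤ (2 : ℝ) ^ r := by
            calc (2 : ℝ) = 2 ^ 1 := by norm_num
              _ ≤ 2 ^ r := pow_le_pow_right₀ (by norm_num) hr
          have : 0 ≤ (2 : ℝ) ^ r := by positivity
          nlinarith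
        exact mul_le_mul_of_nonneg_right h22 hcr

/-! ### The crux text -/

/-- LOCAL COPY of RouteGA's draft crux text `Summit.ABC.ABC.Theses.YuMatveevShapeRat.PadicCoreOddRat` (HOME/plan-m3/next/SketchGA.lean;
the route is not open, so there is no Theses decl to import yet).  When the route opens, `coreOddRat_iff` is re-stated against the
registered decl (same text). [cite: Yu2007, Main Thm (K = ℚ); shape only] -/
def PadicCoreOddRatText : Prop :=
  ∃ c : ℝ, ∀ (p : ℕ), p.Prime → p ≠ 2 →
    ∀ (r : ℕ) (θ : Fin r → ℚ) (m : Fin r → ℤ) (A : Fin r → ℝ) (Amax W : ℝ),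
      (∀ i, θ i ≠ 0 ∧ padicValRat p (θ i) = 0) →
      (∀ μ : Fin r → ℤ, ∏ i, θ i ^ μ i = 1 → μ = 0) →
      (∀ i, Height.logHeight₁ (θ i) ≤ A i) → (∀ i, 1 ≤ A i) → (∀ i, A i ≤ Amax) →
      m ≠ 0 → (∀ i, Real.log (max 3 (|m i| : ℝ)) ≤ W) → 1 ≤ W →
      (padicValRat p (∏ i, θ i ^ m i - 1) : ℝ) * Real.log p ≤
        c ^ r * ((p : ℝ) / Real.log p) * (∏ i, A i) * (W + Real.log p + Real.log (2 * Amax))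

/-- The crux text IS `∃ c, ∀ p odd prime, ∀ r, CoreOddRat (c^·) p r` (definitional unfolding). [folklore] -/
theorem coreOddRat_iff : PadicCoreOddRatText ↔ ∃ c : ℝ, ∀ p : ℕ, p.Prime → p ≠ 2 → ∀ r, CoreOddRat (fun k => c ^ k) p r :=
  Iff.rfl

/-- **The crux from the Kummer-free dichotomy**: if for one constant `c` the Kummer-free per-rank dichotomy holds at every odd prime and every
rank, then the crux text holds. [cite: Nesterenko2003, Thm 2.1 from Prop 2.6] -/
theorem padicCoreOddRatText_of_dichotomy {c : ℝ} (hD : ∀ p : ℕ, p.Prime → p ≠ 2 → ∀ n, DichotomyOddRat (fun k => c ^ k) p n) :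
    PadicCoreOddRatText :=
  ⟨c, fun p hp hp2 => coreRat_of_dichotomy (hD p hp hp2)⟩

/-- **The crux from the positive Kummer-free dichotomy** (odd primes): one constant `0 ≤ c` with the positive per-rank dichotomy at every odd
prime and rank gives RouteGA's crux text (with constant `4c`). [cite: Nesterenko2003, Thm 2.1 from Prop 2.6] -/
theorem padicCoreOddRatText_of_dichotomyPos {c : ℝ} (hc : 0 ≤ c)
    (hD : ∀ p : ℕ, p.Prime → p ≠ 2 → ∀ n, DichotomyOddRatPos (fun k => c ^ k) p n) : PadicCoreOddRatText :=
  ⟨4 * c, fun p hp hp2 => by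
    haveI : Fact p.Prime := ⟨hp⟩
    exact coreOddRat_of_pos hc hp2 (coreRatPos_of_dichotomy (hD p hp hp2))⟩

end Summit.ABC.StewartYu.GenThreeInductionOddRat

end
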